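import Literature.AlgebraicGeometry.Resolution.ToricChartRegularity
import Literature.AlgebraicGeometry.Resolution.TameCyclicEigenparameters
import Literature.AlgebraicGeometry.Resolution.TameCyclicMonomialStructure
import Literature.AlgebraicGeometry.Resolution.ArithmeticalThreefoldsLocalFrameDim
import Literature.AlgebraicGeometry.Resolution.AffineDomainDimension
import Literature.AlgebraicGeometry.Resolution.ExcellentRingsEssFiniteType
import HarnessLib

/-!
# The toric descent step for a tame cyclic action ([CoP1] Lemma 9.4, toric route)

Topic: `Literature/AlgebraicGeometry/Resolution`. PROOF side of `CossartPiltant2019ReductionP`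
(`ArithmeticalThreefoldsLocal.lean`), input (C4) — descent of local uniformization below the
ramification field ([CoP1] Props. 9.3/9.5 with Lemma 9.4). This file ASSEMBLES the local-algebra
core of the descent step of [CoP1] Lemma 9.4 (HAL p. 29: "`S` is stable by `G` … Let `R := S^G` …
the action on `Ŝ ≃ κ(S)[[x₁,x₂,x₃]]` is given by `g.xᵢ = ζ_l^{tᵢ} xᵢ` … `yᵢ := ∏ⱼ xⱼ^{vᵢⱼ}` …
`S₁ := S̄_{𝔪_W ∩ S̄}` is a local model of `W` and `S₁` is regular … `R₁ := S₁^G` … is a local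
uniformization of `V/k`") from the bricks of this topic, on the TORIC ROUTE (the chart of the
nonsingular subdivision of the quotient cone containing the centre, Fulton §2.6, instead of the
pseudo-reflection chart (53)(a) of `ℤ³`, which does not exist for all value groups): for a field
`F` with an automorphism `σ` of finite order `ℓ`, a valuation ring `O` of `F`, and a `σ`-stable
REGULAR local subring `B ⊆ O` of dimension `d` dominated by `O` on which `σ` is tame
(`ℓ ∈ B^×`, `ζ_ℓ ∈ B` fixed) and residually trivial, the ring of invariants `A = B ∩ F^σ` has a
chart `A[y₁, …, y_d] ⊆ O ∩ F^σ` — Laurent monomials in eigen-parameters of `B` — whose local ring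
at the centre of `O` is REGULAR as soon as it has dimension `d`:

* eigen-parameters `x` of `B` (`TameCyclicEigenparameters.lean`, [CoP1] Prop. 6.2 (2));
* `A` is local Noetherian with `𝔪_A` generated by the invariant monomials in `x`
  (`TameCyclicFixedRing.lean`, `TameCyclicMonomialStructure.lean`);
* the regular toric chart of such a ring (`ToricChartRegularity.lean`, `exists_toricChart_isRegularLocalRing`, from
  `InvariantLatticeToricChart.lean` + `MonomialChartCentreUnits.lean`).

* `exists_fixed_toricChart` — PROVED: the `σ`-fixed chart `y`, with `yᵢ ∈ O` fractions of
  invariants, `dim A = d`, `κ(A) = κ(B)`, and regularity of `A[y]_{𝔪_O ∩ A[y]}` granted its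
  dimension is `d`.
* `exists_fixed_toricChart_isRegularLocalRing` — PROVED: the same with the dimension discharged
  by the dimension formula (`A` universally catenary, `κ(O)` algebraic over `κ(B)`).
* `isUniversallyCatenaryRing_locAtCentre_closure` — PROVED: local rings at the centre of finitely
  generated models over a universally catenary (e.g. excellent) subring are universally
  catenary (the form in which the consumer supplies the hypothesis on `A`, cf.
  `TameCyclicFixedModel.lean`, `CyclicInvariantsFiniteType.lean`).

The dimension hypothesis is the dimension formula in the consumer's frame (`A` universally
catenary, residue field of `O` algebraic; `DimensionFormula.lean`). What separates this from
[CoP1] Prop. 9.5 as a whole: the `σ`-stable regular local model upstairs (HAL p. 29 "`S` is stable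
by `G`"), unramified descent (Prop. 9.3) and the prime-degree tower.

Everything is PROVED; no named facts are introduced.

## Sources

* V. Cossart, O. Piltant, *Resolution of singularities of threefolds in positive characteristic.
  I*, J. Algebra 320 (2008) 1051–1082: Prop. 6.2 (2) and proof of Lemma 9.4 (HAL hal-00139124,
  pp. 19, 28–29). [CossartPiltant2008]
* W. Fulton, *Introduction to Toric Varieties*, Ann. of Math. Studies 131 (1993): §2.6
  (pp. 45–50). [Fulton1993Toric]
-/

noncomputable section

namespace Literature.AlgebraicGeometry.Resolution

universe u

open IsLocalRing

section Descent

variable {F : Type u} [Field F] (O : ValuationSubring F)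

/-- `∏ⱼ a^{fⱼ} = a^{∑ fⱼ}` for integer exponents and `a ≠ 0`. [folklore] -/
private theorem prod_zpow_eq_zpow_sum {a : F} (ha : a ≠ 0) {ι : Type*} (s : Finset ι) (f : ι → ℤ) :
    ∏ j ∈ s, a ^ f j = a ^ ∑ j ∈ s, f j := by
  classical
  induction s using Finset.induction_on with
  | empty => simp
  | insert j s hj ih => rw [Finset.prod_insert hj, Finset.sum_insert hj, ih, zpow_add₀ ha]

/-- **The toric descent step for a tame cyclic action** ([CoP1] proof of Lemma 9.4, HAL p. 29,
with the toric chart of the quotient in place of the pseudo-reflection chart (53)). Let `σ` be an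
automorphism of a field `F` with `σ^ℓ = 1`, `O` a valuation ring of `F`, `B ⊆ O` a `σ`-stable
subring which is a REGULAR local ring of dimension `d` dominated by `O`, with `ℓ ∈ B^×`, an
`ℓ`-th root of unity `ζ ∈ B` fixed by `σ` with `ζ^k - 1 ∈ B^×` (`0 < k < ℓ`), and `σ` residually
trivial on `B` (`v(σ b - b) > 0`). Let `A = {b ∈ B : σ b = b}` be the ring of invariants. Then
there are `y₁, …, y_d ∈ O` FIXED by `σ` (Laurent monomials in eigen-parameters of `B`) such that
the local ring of `A[y₁, …, y_d]` at the centre of `O` is a regular local ring provided it has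
dimension `d`; moreover the `yᵢ` are fractions of elements of `A`, `dim A = d` (`B` is finite
over `A`) and `A` and `B` have the same residue field (the data needed to discharge the dimension
hypothesis by the dimension formula, `exists_fixed_toricChart_isRegularLocalRing`).
[cite: CossartPiltant2008, proof of Lemma 9.4 (HAL pp. 28–29)]
[cite: Fulton1993Toric, Section 2.6 (pp. 45–50)] -/
theorem exists_fixed_toricChart (σ : F ≃+* F) (B : Subring F)
    (hBO : B ≤ O.toSubring) (hσB : ∀ b ∈ B, σ b ∈ B) (hBreg : IsRegularLocalRing B) {d : ℕ}
    (hBdim : ringKrullDim B = d)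
    (hdomB : ∀ b : B, b ∈ maximalIdeal B ↔ O.valuation (b : F) < 1)
    {ℓ : ℕ} (hℓ0 : ℓ ≠ 0) (hσℓ : σ ^ ℓ = 1) (hℓu : IsUnit ((ℓ : B)))
    (ζ : F) (hζB : ζ ∈ B) (hσζ : σ ζ = ζ) (hζℓ : ζ ^ ℓ = 1)
    (hζu : ∀ k : ℕ, 0 < k → k < ℓ → IsUnit ((⟨ζ, hζB⟩ : B) ^ k - 1))
    (hres : ∀ b ∈ B, O.valuation (σ b - b) < 1)
    (A : Subring F) (hA : ∀ b, b ∈ A ↔ b ∈ B ∧ σ b = b) :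
    ∃ y : Fin d → F, (∀ i, σ (y i) = y i) ∧ (∀ i, y i ∈ O) ∧
      (∀ i, ∃ a ∈ A, ∃ c ∈ A, c ≠ 0 ∧ y i = a / c) ∧
      ringKrullDim A = d ∧
      (∀ b ∈ B, ∃ a ∈ A, O.valuation (b - a) < 1) ∧
      (ringKrullDim (locAtCentre (Subring.closure ((A : Set F) ∪ Set.range y)) O) = d →
        IsRegularLocalRing (locAtCentre (Subring.closure ((A : Set F) ∪ Set.range y)) O)) := by
  classical
  haveI := hBreg
  have hℓpos : 0 < ℓ := Nat.pos_of_ne_zero hℓ0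
  -- powers of `σ` preserve `B`; `σ⁻¹ = σ^(ℓ-1)`
  have hσpowB : ∀ (k : ℕ) (b : F), b ∈ B → (σ ^ k) b ∈ B := by
    intro k
    induction k with
    | zero => intro b hb; exact hb
    | succ k ih => intro b hb; rw [pow_succ', RingAut.mul_apply]; exact hσB _ (ih b hb)
  have hσsymm : ∀ b : F, σ.symm b = (σ ^ (ℓ - 1)) b := fun b => by
    rw [RingEquiv.symm_apply_eq]
    change b = (σ * σ ^ (ℓ - 1)) b
    rw [← pow_succ', Nat.sub_add_cancel hℓpos, hσℓ]
    rfl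
  have hσBinv : ∀ b ∈ B, σ.symm b ∈ B := fun b hb => by rw [hσsymm]; exact hσpowB _ b hb
  -- `σ` restricted to `B`
  let σB : B ≃+* B :=
    { toFun := fun b => ⟨σ b, hσB b b.2⟩
      invFun := fun b => ⟨σ.symm b, hσBinv b b.2⟩
      left_inv := fun b => Subtype.ext (σ.symm_apply_apply b)
      right_inv := fun b => Subtype.ext (σ.apply_symm_apply b)
      map_mul' := fun a b => Subtype.ext (map_mul σ (a : F) (b : F))
      map_add' := fun a b => Subtype.ext (map_add σ (a : F) (b : F)) }
  have hσB_apply : ∀ b : B, ((σB b : B) : F) = σ b := fun b => rfl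
  have hσBpow : ∀ (k : ℕ) (b : B), (((σB ^ k) b : B) : F) = (σ ^ k) (b : F) := by
    intro k
    induction k with
    | zero => intro b; rfl
    | succ k ih => intro b; rw [pow_succ', RingAut.mul_apply, pow_succ', RingAut.mul_apply, hσB_apply, ih]
  have hσBℓ : σB ^ ℓ = 1 := RingEquiv.ext fun b => Subtype.ext (by
    rw [hσBpow, hσℓ]; rfl)
  let ζB : B := ⟨ζ, hζB⟩
  have hσζB : σB ζB = ζB := Subtype.ext hσζ
  have hζBℓ : ζB ^ ℓ = 1 := Subtype.ext (by
    change ((ζB ^ ℓ : B) : F) = 1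
    rw [SubmonoidClass.coe_pow]; exact hζℓ)
  have hresB : ∀ b : B, σB b - b ∈ maximalIdeal B := fun b => (hdomB _).mpr (hres b b.2)
  -- eigen-parameters ([CoP1] Prop. 6.2 (2))
  obtain ⟨x, t, hspan, ht⟩ :=
    exists_eigen_regularParameters_of_tameCyclic σB hℓ0 hσBℓ hℓu ζB hσζB hζBℓ hζu hBdim
  have hx : ∀ j, σB (x j) = ζB ^ (t j) * x j := fun j => (ht j).2
  -- the ring of invariants inside `B`
  let AB : Subring B := A.comap B.subtype
  have hAB : ∀ b : B, b ∈ AB ↔ σB b = b := fun b => by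
    change (b : F) ∈ A ↔ _
    rw [hA, Subtype.ext_iff, hσB_apply]
    exact ⟨fun h => h.2, fun h => ⟨b.2, h⟩⟩
  haveI hABloc : IsLocalRing AB := isLocalRing_fixedSubring σB AB hAB
  haveI : IsNoetherianRing AB :=
    isNoetherianRing_fixedSubring_of_tameCyclic σB AB hAB hℓ0 hσBℓ hℓu ζB hσζB hζBℓ
  have hmax := maximalIdeal_fixedSubring_eq_span_monomials σB AB hAB hℓ0 hσBℓ hℓu ζB hσζB hζBℓ
    hζu x t hx hresB hspan
  -- transport to `A ⊆ F`
  have hAle : A ≤ B := fun a ha => ((hA a).mp ha).1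
  let e : AB ≃+* A :=
    { toFun := fun a => ⟨((a : B) : F), a.2⟩
      invFun := fun a => ⟨⟨(a : F), hAle a.2⟩, a.2⟩
      left_inv := fun a => rfl
      right_inv := fun a => rfl
      map_mul' := fun a b => rfl
      map_add' := fun a b => rfl }
  have he : ∀ a : AB, ((e a : A) : F) = ((a : B) : F) := fun a => rfl
  haveI : IsLocalRing A := e.isLocalRing
  haveI : IsNoetherianRing A := isNoetherianRing_of_ringEquiv AB e
  -- units of `A` are the units of `B` in `A`
  have hunitA : ∀ a : A, IsUnit a ↔ IsUnit (⟨(a : F), hAle a.2⟩ : B) := by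
    intro a
    refine ⟨fun h => h.map (Subring.inclusion hAle), fun h => ?_⟩
    obtain ⟨v, hv⟩ := h.exists_right_inv
    have hv' : (a : F) * (v : F) = 1 := by
      have := congrArg Subtype.val hv
      simpa using this
    have hσa : σ (a : F) = a := ((hA _).mp a.2).2
    have hσv : σ (v : F) = v := by
      have h1 : (a : F) * σ (v : F) = 1 := by
        have := congrArg σ hv'
        rwa [map_mul, hσa, map_one] at this
      calc σ (v : F) = σ (v : F) * ((a : F) * (v : F)) := by rw [hv', mul_one]
        _ = ((a : F) * σ (v : F)) * (v : F) := by ring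
        _ = v := by rw [h1, one_mul]
    have hvA : (v : F) ∈ A := (hA _).mpr ⟨v.2, hσv⟩
    exact IsUnit.of_mul_eq_one (⟨(v : F), hvA⟩ : A) (Subtype.ext hv')
  have hAO : A ≤ O.toSubring := fun a ha => hBO (hAle ha)
  have hdomA : ∀ a : A, a ∈ maximalIdeal A ↔ O.valuation (a : F) < 1 := fun a => by
    rw [IsLocalRing.mem_maximalIdeal, mem_nonunits_iff, hunitA, ← mem_nonunits_iff,
      ← IsLocalRing.mem_maximalIdeal, hdomB]
  -- the invariant monomials, as a generating set of `𝔪_A` inside `F`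
  let xF : Fin d → F := fun j => ((x j : B) : F)
  have hxO : ∀ j, xF j ∈ O := fun j => hBO (x j).2
  let GB : Set AB := {a : AB | ∃ w : Fin d → ℕ, (∀ j, w j ≤ ℓ) ∧ w ≠ 0 ∧
    (∑ j, t j * w j) % ℓ = 0 ∧ (a : B) = ∏ j, x j ^ w j}
  let G : Set A := e '' GB
  have hG : Ideal.span G = maximalIdeal A := by
    change Ideal.span ((e : AB →+* A) '' GB) = _
    rw [← Ideal.map_span, ← hmax]
    exact IsLocalRing.map_ringEquiv_maximalIdeal e
  have hGmon : ∀ g ∈ G, ∃ w : Fin d → ℕ, (∑ j, t j * w j) % ℓ = 0 ∧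
      ((g : A) : F) = ∏ j, xF j ^ w j := by
    rintro _ ⟨a, ⟨w, -, -, hw, haw⟩, rfl⟩
    refine ⟨w, hw, ?_⟩
    rw [he, haw]
    show ((∏ j, x j ^ w j : B) : F) = ∏ j, ((x j : B) : F) ^ w j
    norm_cast
  -- the parameters are non-zero: `𝔪_B` needs `d = dim B` generators
  have hx0 : ∀ j, xF j ≠ 0 := by
    intro j₀ h0
    have hxj : x j₀ = 0 := Subtype.ext h0
    have hspan' : Ideal.span (((Finset.univ.erase j₀).image x : Finset B) : Set B) =
        maximalIdeal B := by
      rw [← hspan]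
      apply le_antisymm
      · refine Ideal.span_mono ?_
        intro b hb
        obtain ⟨j, -, rfl⟩ := Finset.mem_image.mp (Finset.mem_coe.mp hb)
        exact ⟨j, rfl⟩
      · refine Ideal.span_le.mpr ?_
        rintro _ ⟨j, rfl⟩
        by_cases hj : j = j₀
        · subst hj; rw [hxj]; exact Ideal.zero_mem _
        · exact Ideal.subset_span (Finset.mem_coe.mpr (Finset.mem_image.mpr
            ⟨j, Finset.mem_erase.mpr ⟨hj, Finset.mem_univ j⟩, rfl⟩))
    have h1 : ((maximalIdeal B).spanFinrank : WithBot ℕ∞) = ringKrullDim B :=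
      IsRegularLocalRing.spanFinrank_maximalIdeal
    have h2 : (maximalIdeal B).spanFinrank ≤ d - 1 := by
      rw [← hspan']
      calc (Ideal.span (((Finset.univ.erase j₀).image x : Finset B) : Set B)).spanFinrank
          ≤ (((Finset.univ.erase j₀).image x : Finset B) : Set B).ncard :=
            Submodule.spanFinrank_span_le_ncard_of_finite (Finset.finite_toSet _)
        _ = ((Finset.univ.erase j₀).image x).card := Set.ncard_coe_finset _
        _ ≤ (Finset.univ.erase j₀).card := Finset.card_image_le
        _ = d - 1 := by rw [Finset.card_erase_of_mem (Finset.mem_univ _), Finset.card_univ,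
            Fintype.card_fin]
    rw [hBdim] at h1
    have h3 : (maximalIdeal B).spanFinrank = d := by exact_mod_cast h1
    have : 0 < d := Fin.pos j₀
    omega
  -- the regular toric chart of the ring of invariants
  obtain ⟨n, hdvd, hyO, -, hreg⟩ :=
    exists_toricChart_isRegularLocalRing O A hAO hdomA hℓpos t xF hx0 hxO G hG hGmon
  have hζ0 : ζ ≠ 0 := fun h => by
    rw [h, zero_pow hℓ0] at hζℓ; exact zero_ne_one hζℓ
  have hσx : ∀ j, σ (xF j) = ζ ^ t j * xF j := fun j => by
    have h := congrArg (fun b : B => (b : F)) (hx j)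
    simpa [hσB_apply, xF] using h
  -- invariant monomials `x^w`, `ℓ ∣ t·w`, lie in `A`
  have hmonA : ∀ w : Fin d → ℕ, ℓ ∣ ∑ j, t j * w j → (∏ j, xF j ^ w j) ∈ A := by
    intro w hw
    rw [hA]
    refine ⟨B.prod_mem fun j _ => B.pow_mem (x j).2 _, ?_⟩
    obtain ⟨q, hq⟩ := hw
    calc σ (∏ j, xF j ^ w j) = ∏ j, (ζ ^ t j * xF j) ^ w j := by
          rw [map_prod]; exact Finset.prod_congr rfl fun j _ => by rw [map_pow, hσx]
      _ = ζ ^ (∑ j, t j * w j) * ∏ j, xF j ^ w j := by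
          rw [← Finset.prod_pow_eq_pow_sum, ← Finset.prod_mul_distrib]
          exact Finset.prod_congr rfl fun j _ => by rw [mul_pow, pow_mul]
      _ = ∏ j, xF j ^ w j := by rw [hq, pow_mul, hζℓ, one_pow, one_mul]
  -- `dim A = d`: `B` is finite over the ring of invariants
  have hdimA : ringKrullDim A = d := by
    haveI : Module.Finite AB B :=
      module_finite_fixedSubring_of_tameCyclic σB AB hAB hℓ0 hσBℓ hℓu ζB hσζB hζBℓ hζu
    haveI : Algebra.IsIntegral AB B := Algebra.IsIntegral.of_finite AB B
    have h1 : ringKrullDim B = ringKrullDim AB :=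
      ringKrullDim_eq_of_isIntegral (R := AB) (S := B) Subtype.val_injective
    rw [← ringKrullDim_eq_of_ringEquiv e, ← h1, hBdim]
  -- `A` and `B` have the same residue field
  have hresA : ∀ b ∈ B, ∃ a ∈ A, O.valuation (b - a) < 1 := by
    intro b hb
    obtain ⟨a, ha⟩ := exists_sub_mem_maximalIdeal_of_residuallyTrivial σB AB hAB hℓ0 hσBℓ hℓu
      hresB ⟨b, hb⟩
    exact ⟨((a : B) : F), a.2, (hdomB _).mp ha⟩
  refine ⟨fun i => ∏ j, xF j ^ n i j, fun i => ?_, hyO, fun i => ?_, hdimA, hresA, hreg⟩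
  · -- the chart is fixed by `σ`: `σ(x^{nᵢ}) = ζ^{t·nᵢ} x^{nᵢ} = x^{nᵢ}`
    obtain ⟨m, hm⟩ := hdvd i
    calc σ (∏ j, xF j ^ n i j) = ∏ j, (ζ ^ t j * xF j) ^ n i j := by
          rw [map_prod]; exact Finset.prod_congr rfl fun j _ => by rw [map_zpow₀, hσx]
      _ = (∏ j, ζ ^ ((t j : ℤ) * n i j)) * ∏ j, xF j ^ n i j := by
          rw [← Finset.prod_mul_distrib]
          exact Finset.prod_congr rfl fun j _ => by rw [mul_zpow, zpow_mul, zpow_natCast]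
      _ = ∏ j, xF j ^ n i j := by
          rw [prod_zpow_eq_zpow_sum hζ0, hm, zpow_mul, zpow_natCast, hζℓ, one_zpow, one_mul]
  · -- `yᵢ = x^{n⁺ + (ℓ-1) n⁻} / x^{ℓ n⁻}`, a fraction of invariant monomials
    let np : Fin d → ℕ := fun j => (n i j).toNat
    let nm : Fin d → ℕ := fun j => (-n i j).toNat
    have hnpm : ∀ j, (np j : ℤ) - nm j = n i j := fun j => Int.toNat_sub_toNat_neg _
    obtain ⟨m, hm⟩ := hdvd i
    refine ⟨∏ j, xF j ^ (np j + (ℓ - 1) * nm j), hmonA _ ?_, ∏ j, xF j ^ (ℓ * nm j), hmonA _ ?_,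
      Finset.prod_ne_zero_iff.mpr fun j _ => pow_ne_zero _ (hx0 j), ?_⟩
    · -- `t·(n⁺ + (ℓ-1)n⁻) = t·n + ℓ t·n⁻`
      have h1 : ((∑ j, t j * (np j + (ℓ - 1) * nm j) : ℕ) : ℤ) =
          (∑ j, (t j : ℤ) * n i j) + ℓ * ∑ j, (t j : ℤ) * nm j := by
        push_cast
        rw [Finset.mul_sum, ← Finset.sum_add_distrib]
        refine Finset.sum_congr rfl fun j _ => ?_
        rw [← hnpm j, Nat.cast_sub hℓpos]
        push_cast
        ring
      have h2 : ((ℓ : ℕ) : ℤ) ∣ ((∑ j, t j * (np j + (ℓ - 1) * nm j) : ℕ) : ℤ) := by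
        rw [h1, hm]
        exact dvd_add (dvd_mul_right _ _) (dvd_mul_right _ _)
      exact Int.natCast_dvd_natCast.mp h2
    · rw [show (∑ j, t j * (ℓ * nm j)) = ℓ * ∑ j, t j * nm j by
        rw [Finset.mul_sum]; exact Finset.sum_congr rfl fun j _ => by ring]
      exact dvd_mul_right _ _
    · rw [eq_div_iff (Finset.prod_ne_zero_iff.mpr fun j _ => pow_ne_zero _ (hx0 j)),
        ← Finset.prod_mul_distrib]
      refine Finset.prod_congr rfl fun j _ => ?_
      rw [← zpow_natCast, ← zpow_natCast, ← zpow_add₀ (hx0 j)]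
      congr 1
      rw [← hnpm j]
      push_cast
      rw [Nat.cast_sub hℓpos]
      push_cast
      ring

/-- **The toric descent step, dimension discharged** ([CoP1] proof of Lemma 9.4, HAL p. 29:
"`R₁ := S₁^G` … `S₁^G` is a local uniformization of `V/k`", toric route): in the situation of
`exists_fixed_toricChart`, if moreover the ring of invariants `A` is universally catenary
(e.g. essentially of finite type over an excellent ring) and the residue field of `O` is
algebraic over that of `B` (every element of `O` is a root modulo `𝔪_O` of a polynomial over
`B` with a unit coefficient — Cossart–Piltant's residually algebraic rank-one frame), then the
`σ`-fixed chart `A[y₁, …, y_d] ⊆ O` has a REGULAR local ring at the centre of `O`: the dimension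
hypothesis is the dimension formula (`ringKrullDim_locAtCentre_closure_eq`, Matsumura Thm. 15.6)
for the fractions `yᵢ` of elements of `A`, with `dim A = dim B = d`.
[cite: CossartPiltant2008, proof of Lemma 9.4 (HAL pp. 28–29)]
[cite: Fulton1993Toric, Section 2.6 (pp. 45–50)] -/
theorem exists_fixed_toricChart_isRegularLocalRing (σ : F ≃+* F) (B : Subring F)
    (hBO : B ≤ O.toSubring) (hσB : ∀ b ∈ B, σ b ∈ B) (hBreg : IsRegularLocalRing B) {d : ℕ}
    (hBdim : ringKrullDim B = d)
    (hdomB : ∀ b : B, b ∈ maximalIdeal B ↔ O.valuation (b : F) < 1)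
    (halgB : ∀ z : O, ∃ q : Polynomial B, (∃ i, IsUnit (q.coeff i)) ∧
      O.valuation (Polynomial.aeval (z : F) q) < 1)
    {ℓ : ℕ} (hℓ0 : ℓ ≠ 0) (hσℓ : σ ^ ℓ = 1) (hℓu : IsUnit ((ℓ : B)))
    (ζ : F) (hζB : ζ ∈ B) (hσζ : σ ζ = ζ) (hζℓ : ζ ^ ℓ = 1)
    (hζu : ∀ k : ℕ, 0 < k → k < ℓ → IsUnit ((⟨ζ, hζB⟩ : B) ^ k - 1))
    (hres : ∀ b ∈ B, O.valuation (σ b - b) < 1)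
    (A : Subring F) (hA : ∀ b, b ∈ A ↔ b ∈ B ∧ σ b = b)
    (hAuc : IsUniversallyCatenaryRing A) :
    ∃ y : Fin d → F, (∀ i, σ (y i) = y i) ∧ (∀ i, y i ∈ O) ∧
      IsRegularLocalRing (locAtCentre (Subring.closure ((A : Set F) ∪ Set.range y)) O) := by
  classical
  obtain ⟨y, hσy, hyO, hfrac, hdimA, hresA, hreg⟩ := exists_fixed_toricChart O σ B hBO hσB hBreg
    hBdim hdomB hℓ0 hσℓ hℓu ζ hζB hσζ hζℓ hζu hres A hA
  refine ⟨y, hσy, hyO, hreg ?_⟩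
  have hAle : A ≤ B := fun a ha => ((hA a).mp ha).1
  have hAO : A ≤ O.toSubring := fun a ha => hBO (hAle ha)
  haveI : IsNoetherianRing A := hAuc.1
  -- `A` is local, dominated by `O` (units of `A` = units of `B` in `A`)
  haveI hBloc : IsLocalRing B := inferInstance
  have hunitA : ∀ a : A, IsUnit a ↔ IsUnit (⟨(a : F), hAle a.2⟩ : B) := by
    intro a
    refine ⟨fun h => h.map (Subring.inclusion hAle), fun h => ?_⟩
    obtain ⟨v, hv⟩ := h.exists_right_inv
    have hv' : (a : F) * (v : F) = 1 := by
      have := congrArg Subtype.val hv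
      simpa using this
    have hσa : σ (a : F) = a := ((hA _).mp a.2).2
    have hσv : σ (v : F) = v := by
      have h1 : (a : F) * σ (v : F) = 1 := by
        have := congrArg σ hv'
        rwa [map_mul, hσa, map_one] at this
      calc σ (v : F) = σ (v : F) * ((a : F) * (v : F)) := by rw [hv', mul_one]
        _ = ((a : F) * σ (v : F)) * (v : F) := by ring
        _ = v := by rw [h1, one_mul]
    exact IsUnit.of_mul_eq_one (⟨(v : F), (hA _).mpr ⟨v.2, hσv⟩⟩ : A) (Subtype.ext hv')
  haveI : IsLocalRing A := by
    haveI : Nontrivial A := A.subtype.domain_nontrivial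
    refine IsLocalRing.of_nonunits_add fun a b ha hb => ?_
    rw [mem_nonunits_iff, hunitA, ← mem_nonunits_iff, ← IsLocalRing.mem_maximalIdeal] at ha hb ⊢
    exact Ideal.add_mem _ ha hb
  have hdomA : ∀ a : A, a ∈ maximalIdeal A → O.valuation (a : F) < 1 := fun a ha => by
    rw [IsLocalRing.mem_maximalIdeal, mem_nonunits_iff, hunitA, ← mem_nonunits_iff,
      ← IsLocalRing.mem_maximalIdeal, hdomB] at ha
    exact ha
  -- residual algebraicity over `A` (same residue field as `B`)
  have halgA : ∀ z : O, ∃ q : Polynomial A, (∃ i, q.coeff i ∉ maximalIdeal A) ∧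
      O.valuation (Polynomial.aeval (z : F) q) < 1 := by
    intro z
    obtain ⟨q, ⟨i₀, hi₀⟩, hqz⟩ := halgB z
    -- replace each coefficient by an invariant with the same residue
    have hcoef : ∀ k, ∃ a : A, O.valuation (((q.coeff k : B) : F) - (a : F)) < 1 := fun k => by
      obtain ⟨a, haA, ha⟩ := hresA _ (q.coeff k).2
      exact ⟨⟨a, haA⟩, ha⟩
    choose c hc using hcoef
    let qA : Polynomial A := ∑ k ∈ q.support, Polynomial.monomial k (c k)
    have hqAcoeff : ∀ k, qA.coeff k = if k ∈ q.support then c k else 0 := fun k => by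
      simp only [qA, Polynomial.finsetSum_coeff, Polynomial.coeff_monomial]
      rw [Finset.sum_ite_eq']
    have hi₀s : i₀ ∈ q.support := Polynomial.mem_support_iff.mpr hi₀.ne_zero
    refine ⟨qA, ⟨i₀, ?_⟩, ?_⟩
    · -- the unit coefficient stays a unit: `c i₀ ≡ q.coeff i₀ (mod 𝔪_B)`
      rw [hqAcoeff, if_pos hi₀s]
      intro hmem
      have hcB : (⟨(c i₀ : F), hAle (c i₀).2⟩ : B) ∈ maximalIdeal B := by
        rw [IsLocalRing.mem_maximalIdeal, mem_nonunits_iff, ← hunitA, ← mem_nonunits_iff,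
          ← IsLocalRing.mem_maximalIdeal]
        exact hmem
      have hdiff : q.coeff i₀ - ⟨(c i₀ : F), hAle (c i₀).2⟩ ∈ maximalIdeal B :=
        (hdomB _).mpr (hc i₀)
      have hq₀ : q.coeff i₀ ∈ maximalIdeal B := by
        have := Ideal.add_mem _ hdiff hcB
        rwa [sub_add_cancel] at this
      exact (IsLocalRing.mem_maximalIdeal _ |>.mp hq₀) hi₀
    · -- `q(z) - qA(z) = ∑ (q_k - c_k) z^k` has positive value
      have hzv : O.valuation (z : F) ≤ 1 := (O.valuation_le_one_iff _).mpr z.2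
      have hqA : Polynomial.aeval (z : F) qA = ∑ k ∈ q.support, ((c k : A) : F) * (z : F) ^ k := by
        simp only [qA, map_sum, Polynomial.aeval_monomial]
        rfl
      have hq : Polynomial.aeval (z : F) q =
          ∑ k ∈ q.support, ((q.coeff k : B) : F) * (z : F) ^ k := by
        conv_lhs => rw [q.as_sum_support]
        simp only [map_sum, Polynomial.aeval_monomial]
        rfl
      have hdiff : Polynomial.aeval (z : F) q - Polynomial.aeval (z : F) qA =
          ∑ k ∈ q.support, (((q.coeff k : B) : F) - ((c k : A) : F)) * (z : F) ^ k := by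
        rw [hq, hqA, ← Finset.sum_sub_distrib]
        exact Finset.sum_congr rfl fun k _ => by ring
      have hdv : O.valuation (Polynomial.aeval (z : F) q - Polynomial.aeval (z : F) qA) < 1 := by
        rw [hdiff]
        refine O.valuation.map_sum_lt one_ne_zero fun k _ => ?_
        rw [map_mul, map_pow]
        exact lt_of_le_of_lt (mul_le_of_le_one_right' (pow_le_one' hzv _)) (hc k)
      have heq : Polynomial.aeval (z : F) qA =
          Polynomial.aeval (z : F) q - (Polynomial.aeval (z : F) q - Polynomial.aeval (z : F) qA) := by
        ring
      rw [heq]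
      exact O.valuation.map_sub_lt hqz hdv
  -- the dimension formula for the fractions `yᵢ` over the universally catenary `A`
  have hb : ∀ w ∈ (Finset.univ.image y : Finset F), ∃ a c : A, (c : F) ≠ 0 ∧ w = a / c := by
    intro w hw
    obtain ⟨i, -, rfl⟩ := Finset.mem_image.mp hw
    obtain ⟨a, ha, c, hc, hc0, hy⟩ := hfrac i
    exact ⟨⟨a, ha⟩, ⟨c, hc⟩, hc0, hy⟩
  have hrange : ((Finset.univ.image y : Finset F) : Set F) = Set.range y := by
    rw [Finset.coe_image, Finset.coe_univ, Set.image_univ]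
  have hTO : Subring.closure ((A : Set F) ∪ ↑(Finset.univ.image y : Finset F)) ≤ O.toSubring := by
    rw [hrange]
    exact Subring.closure_le.mpr (Set.union_subset hAO (by rintro _ ⟨i, rfl⟩; exact hyO i))
  have h := ringKrullDim_locAtCentre_closure_eq O hAuc hAO hdomA halgA (Finset.univ.image y) hb hTO
  rw [hrange, hdimA] at h
  exact h

/-- **Local rings at the centre of finitely generated models over a universally catenary ring are
universally catenary** (Stacks 00NJ/0ECE through `IsUniversallyCatenaryRing.of_finiteType` and
`.of_isLocalization`): for a subring `S ⊆ F` which is universally catenary (e.g. excellent) and a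
finite `t ⊆ F` with `S[t] ⊆ O`, the local ring `S[t]_{𝔪_O ∩ S[t]} = locAtCentre S[t] O` is
universally catenary — the hypothesis of the dimension formula in
`exists_fixed_toricChart_isRegularLocalRing` for rings of invariants presented as such local
rings (`TameCyclicFixedModel.lean`, `CyclicInvariantsFiniteType.lean`).
[cite: StacksProject, Tag 00NJ] -/
theorem isUniversallyCatenaryRing_locAtCentre_closure (S : Subring F)
    (hS : IsUniversallyCatenaryRing S) (t : Finset F)
    (hTO : Subring.closure ((S : Set F) ∪ ↑t) ≤ O.toSubring) :
    IsUniversallyCatenaryRing (locAtCentre (Subring.closure ((S : Set F) ∪ ↑t)) O) := by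
  classical
  set T := Subring.closure ((S : Set F) ∪ ↑t) with hT
  have e : (Algebra.adjoin S (t : Set F)).toSubring = T := by
    rw [Algebra.adjoin_eq_ring_closure, hT]
    congr 1
    ext z
    simp only [Set.mem_union, SetLike.mem_coe, Set.mem_range]
    constructor
    · rintro (⟨w, rfl⟩ | hz)
      · exact Or.inl w.2
      · exact Or.inr hz
    · rintro (hz | hz)
      · exact Or.inl ⟨⟨z, hz⟩, rfl⟩
      · exact Or.inr hz
  haveI : Algebra.FiniteType S (Algebra.adjoin S (t : Set F)) :=
    (Subalgebra.fg_iff_finiteType _).mp (Subalgebra.fg_adjoin_finset _)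
  have hadj : IsUniversallyCatenaryRing (Algebra.adjoin S (t : Set F)) := hS.of_finiteType _
  -- transport along `S[t] = T`
  let f : Algebra.adjoin S (t : Set F) →+* T :=
    { toFun := fun x => ⟨(x : F), by rw [← e]; exact x.2⟩
      map_one' := rfl
      map_mul' := fun _ _ => rfl
      map_zero' := rfl
      map_add' := fun _ _ => rfl }
  have hf : Function.Surjective f := fun y => ⟨⟨(y : F), by
    have h : (y : F) ∈ (Algebra.adjoin S (t : Set F)).toSubring := by rw [e]; exact y.2
    exact h⟩, rfl⟩
  have hTuc : IsUniversallyCatenaryRing T := hadj.of_surjective f hf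
  haveI := isLocalization_locAtCentre hTO
  exact hTuc.of_isLocalization (subringCentre T O hTO).primeCompl

end Descent

end Literature.AlgebraicGeometry.Resolution

end
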